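import Summits.Parity.BatemanHorn.Theorems.RoughParitySectorsOddSectorShareLinearPrimeBackgroundCounting
import Summits.Parity.BatemanHorn.Theorems.RoughParitySectorsOddSectorShareLinearPrimeBackgroundCells
import Summits.Parity.BatemanHorn.Theorems.RoughParitySectorsOddSectorShareLinearPrimeBackgroundAsymptotics
import Summits.Parity.BatemanHorn.Theorems.RoughParitySectorsOddSectorShareLinearPrimeBackgroundValues
import HarnessLib

/-!
# Route `RoughParitySectors`, crux `OddSectorShareLinear` (stmt-Parity-15629), line `birth`:
# the PRIME-BACKGROUND STEP of the mixed share anatomy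

`--supports stmt-Parity-15629` file (line lead, cycle 2). The crux is equivalent, system by system, to the
mixed share ANATOMY `|c⁽ᵐ⁺¹⁾(x,U)·T(U) − c⁽ᵐ⁾(x,U)| ≤ η·c⁽ᵐ⁾(x,U)` for all members `m`
(`…MixedShareStep.lean`, `OddSectorShareLinear_of_mixedShareAnatomy`). This file PROVES the anatomy at
the LAST member `m` (background: every other member prime) from a Bombieri structure on the sequence
along `f_m` on that background, a prime floor, a polylogarithmic density, and Bombieri's law on `P_r`
(`Literature.NumberTheory.Sieve.Bombieri1976_PrDistributionMin`, [BombieriRIMS1977] p. 5):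
`mixedShareAnatomy_of_primeBackgroundBombieri` (= registered sub-goal `stub_primeBackgroundAnatomy`).
For `k = 2` (twins `(X, X+2)`, …) the hypotheses are: EH-strength level of distribution for the shifted
primes in Bombieri's form (A₁)–(A₅) (cf. tree `isBombieriSequence_shiftedPrimesCounting_two` for
`Λ(n+2)` under EH), the Hardy–Littlewood LOWER bound `π₂(x) ≫ x/log²x` (the floor; necessary for the
method), and Chebyshev for the background (density). Inputs: `BombieriRoughCells.primeShare_of_floor`,
`…PrimeBackgroundCells` (identifications), `…PrimeBackgroundCounting` (error sets),
`…PrimeBackgroundAsymptotics` (budget), `…PrimeBackgroundValues` (bookkeeping). No definition, no fact.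
-/

noncomputable section

open Filter Finset Polynomial Asymptotics
open scoped BigOperators Topology ArithmeticFunction.omega ArithmeticFunction.Omega
open Literature.NumberTheory.Sieve

namespace Summit.Parity.BatemanHorn.Cruxes.OddSectorShareLinear.Birth

/-- **The prime-background step of the mixed share anatomy** (line `birth`, crux stmt-Parity-15629).
Let `f` be an all-linear Bateman–Horn system and `m` its LAST member.  Suppose the sequence along `f_m`
on the background "every other member prime" — weight `a_v = 1` if `v = f_m(n)` for some `n ≥ 1` with
`f_i(n)` prime for all `i < m`, `a_v = 0` otherwise — carries a Bombieri structure (A₁)–(A₅) with a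
density constant `H` (EH-strength for `k = 2`, Hardy–Littlewood-strength for `k ≥ 3`), a FLOOR
`∑_{p ≤ X} a_p ≥ δ₀ A(X)/log X` (`δ₀ > 0`: the prime `m`-tuples are not sparse relative to the
background) and a polylogarithmic density `A(X) ≥ X/(log X)^B`.  Then, given Bombieri's law on every
`P_r` (`Bombieri1976_PrDistributionMin`), the mixed share ANATOMY holds at `(f, m)`:
for every `η > 0`, for `U ≥ 3`, eventually in `x`, `|c⁽ᵐ⁺¹⁾(x,U)·T(U) − c⁽ᵐ⁾(x,U)| ≤ η·c⁽ᵐ⁾(x,U)`,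
`T(U) = Σ_{j odd ≤ ⌊U⌋} I_j(U)` — on the all-prime background member `m`'s primes have the INTEGER share
of its odd sector (the ghost `δ_x` of Bombieri's law cancels inside the odd sector; the floor makes the
`o(A/log x)` errors relative).  Proof: `BombieriRoughCells.primeShare_of_floor` for the sequence at
`X = f_m(x)` with threshold `⌈x^{1/U}⌉₊`, the identifications `…PrimeBackgroundCells`, the counting
bounds `…PrimeBackgroundCounting` (other members `< z`: `≤ k z + Σ|bᵢ|`; non-squarefree rough values:
`≤ 2x/z + √X + 1`; `Ω ≤ ⌊U⌋`), the budget `…PrimeBackgroundAsymptotics`, and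
`PrimeBackground.anatomy_of_share`. [folklore] -/
theorem mixedShareAnatomy_of_primeBackgroundBombieri :
    Literature.NumberTheory.Sieve.Bombieri1976_PrDistributionMin → ∀ (k : ℕ) (f : Fin k →
    Polynomial ℤ), Literature.NumberTheory.Sieve.IsBatemanHornSystem f → (∀ i, (f i).natDegree ≤ 1)
    → ∀ m : Fin k, (m : ℕ) + 1 = k → (∃ (A : Literature.NumberTheory.Sieve.SieveSequence) (H δ₀ B :
    ℝ), (∀ (v n : ℕ), 1 ≤ n → (f m).eval (n : ℤ) = v → (∀ i : Fin k, (i : ℕ) < (m : ℕ) → (((f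
    i).eval (n : ℤ)).toNat).Prime) → A.a v = 1) ∧ (∀ v : ℕ, (∀ n : ℕ, 1 ≤ n → (f m).eval (n : ℤ) =
    v → ¬ (∀ i : Fin k, (i : ℕ) < (m : ℕ) → (((f i).eval (n : ℤ)).toNat).Prime)) → A.a v = 0) ∧
    A.IsBombieriSequence ∧ A.HasDensityConstant H ∧ 0 < δ₀ ∧ (∀ᶠ X : ℝ in Filter.atTop, δ₀ *
    (A.size X / Real.log X) ≤ ∑ p ∈ Nat.primesLE ⌊X⌋₊, A.a p) ∧ (∀ᶠ X : ℝ in Filter.atTop, X /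
    Real.log X ^ B ≤ A.size X)) → ∀ η : ℝ, 0 < η → ∃ U₀ : ℝ, ∀ U : ℝ, U₀ ≤ U → ∀ᶠ x : ℕ in
    Filter.atTop, |(((((Finset.Icc 1 x).filter (fun n : ℕ => ∀ i, 0 < (f i).eval (n : ℤ) ∧ ∀ p ∈
    Finset.range ⌈(x : ℝ) ^ (((f i).natDegree : ℝ) / U)⌉₊, p.Prime → ¬ ((p : ℤ) ∣ (f i).eval (n :
    ℤ)))).filter (fun n : ℕ => ∀ i : Fin k, ((i : ℕ) < (m : ℕ) + 1 → ArithmeticFunction.cardFactors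
    (((f i).eval (n : ℤ)).toNat) = 1) ∧ ((m : ℕ) + 1 ≤ (i : ℕ) → Odd
    (ArithmeticFunction.cardFactors (((f i).eval (n : ℤ)).toNat))))).card : ℕ) : ℝ) * (∑ j ∈
    (Finset.range (⌊U⌋₊ + 1)).filter Odd, Literature.NumberTheory.Sieve.roughCellDensity j U) -
    (((((Finset.Icc 1 x).filter (fun n : ℕ => ∀ i, 0 < (f i).eval (n : ℤ) ∧ ∀ p ∈ Finset.range ⌈(x
    : ℝ) ^ (((f i).natDegree : ℝ) / U)⌉₊, p.Prime → ¬ ((p : ℤ) ∣ (f i).eval (n : ℤ)))).filter (fun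
    n : ℕ => ∀ i : Fin k, ((i : ℕ) < (m : ℕ) → ArithmeticFunction.cardFactors (((f i).eval (n :
    ℤ)).toNat) = 1) ∧ ((m : ℕ) ≤ (i : ℕ) → Odd (ArithmeticFunction.cardFactors (((f i).eval (n :
    ℤ)).toNat))))).card : ℕ) : ℝ)| ≤ η * (((((Finset.Icc 1 x).filter (fun n : ℕ => ∀ i, 0 < (f
    i).eval (n : ℤ) ∧ ∀ p ∈ Finset.range ⌈(x : ℝ) ^ (((f i).natDegree : ℝ) / U)⌉₊, p.Prime → ¬ ((p
    : ℤ) ∣ (f i).eval (n : ℤ)))).filter (fun n : ℕ => ∀ i : Fin k, ((i : ℕ) < (m : ℕ) →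
    ArithmeticFunction.cardFactors (((f i).eval (n : ℤ)).toNat) = 1) ∧ ((m : ℕ) ≤ (i : ℕ) → Odd
    (ArithmeticFunction.cardFactors (((f i).eval (n : ℤ)).toNat))))).card : ℕ) : ℝ) := by
  intro hPr k f hf hdeg m hmk hHBF η hη
  obtain ⟨A, H, δ₀, B, hw1, hw0, hA, hH, hδ₀, hfloor, hdense⟩ := hHBF
  refine ⟨3, fun U hU => ?_⟩
  -- the member `f m = a X + b`
  obtain ⟨ha, hev, hcop⟩ := PrimeBackground.linear_member hf hdeg m
  set a : ℤ := (f m).coeff 1 with ha_def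
  set b : ℤ := (f m).coeff 0 with hb_def
  have ha1 : (1 : ℝ) ≤ (a : ℝ) := by exact_mod_cast ha
  have ha0 : (0 : ℝ) < (a : ℝ) := by linarith
  have hdeg1 : ∀ i, (f i).natDegree = 1 := fun i => by
    have := hf.natDegree_pos i; have := hdeg i; omega
  -- constants
  have hU1 : (1 : ℝ) < U := by linarith
  have hU0 : (0 : ℝ) < U := by linarith
  set R : ℕ := ⌊U⌋₊ with hR
  have hR1 : 1 ≤ R := Nat.le_floor (by norm_num; linarith)
  set T : ℝ := BombieriRoughCells.oddMassR R U with hT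
  have hT1 : 1 ≤ T := BombieriRoughCells.one_le_oddMassR hR1 hU1.le
  set ε : ℝ := min (η / 3) (1 / 4) with hε
  have hε0 : 0 < ε := lt_min (by positivity) (by norm_num)
  have hε1 : ε ≤ 1 / 4 := min_le_right _ _
  have hε3 : 3 * ε ≤ η := by linarith [min_le_left (η / 3) (1 / 4)]
  -- the background and the weights in the form of `…PrimeBackgroundCells`
  set bg : ℕ → Prop := fun n => ∀ i : Fin k, (i : ℕ) < (m : ℕ) → (((f i).eval (n : ℤ)).toNat).Prime
    with hbg
  have hw1' : ∀ v : ℕ, (∃ n : ℕ, 1 ≤ n ∧ a * n + b = v ∧ bg n) → A.a v = 1 :=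
    fun v ⟨n, hn1, hnv, hB⟩ => hw1 v n hn1 (by rw [hev]; exact hnv) hB
  have hw0' : ∀ v : ℕ, (¬ ∃ n : ℕ, 1 ≤ n ∧ a * n + b = v ∧ bg n) → A.a v = 0 :=
    fun v hne => hw0 v fun n hn1 hnv hB => hne ⟨n, hn1, by rw [← hev]; exact hnv, hB⟩
  -- the Literature share statement for the sequence, threshold `y(X) = ⌈((X-b)/a)^{1/U}⌉₊`
  set y : ℝ → ℝ := fun X => (⌈((X - (b : ℝ)) / (a : ℝ)) ^ (1 / U)⌉₊ : ℝ) with hy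
  have hy0 : ∀ᶠ X : ℝ in atTop, 0 < y X := PrimeBackground.eventually_threshold_pos ha0 _ hU0
  have hy2 : ∀ᶠ X : ℝ in atTop, y X ≤ Real.sqrt X := PrimeBackground.eventually_threshold_le_sqrt ha1 _ hU
  have hyl : Tendsto (fun X => Real.log (y X) / Real.log X) atTop (𝓝 (1 / U)) :=
    PrimeBackground.tendsto_log_threshold_div_log ha0 _ hU0
  have hshare := BombieriRoughCells.primeShare_of_floor hPr hA hH hU1 hR1 hy0 hy2 hyl hδ₀ hfloor ε hε0
  -- lower bound for the odd sector: `O ≥ (T/2) P`, and for the prime count: `P ≥ δ₀ X/log^{B+1} X`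
  have hO : ∀ᶠ X : ℝ in atTop, T / 2 * (∑ p ∈ Nat.primesLE ⌊X⌋₊, A.a p) ≤
      BombieriRoughCells.oddCells A R (y X) X := by
    have h := (BombieriRoughCells.oddCells_isLittleO hPr hA hH hU1 R hy0 hy2 hyl).def
      (show 0 < δ₀ * (T / 2) by positivity)
    filter_upwards [h, hfloor, eventually_gt_atTop (1 : ℝ)] with X hX hXf hX1
    have hXnn : 0 ≤ A.size X := SieveSequence.size_nonneg_of_size_eq hA.1 X
    have hAL : 0 ≤ A.size X / Real.log X := div_nonneg hXnn (Real.log_pos hX1).le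
    rw [Real.norm_eq_abs, Real.norm_eq_abs, abs_of_nonneg hAL] at hX
    have h1 := (abs_le.mp hX).1
    have : δ₀ * (T / 2) * (A.size X / Real.log X) ≤ T / 2 * ∑ p ∈ Nat.primesLE ⌊X⌋₊, A.a p := by
      nlinarith
    rw [hT] at *
    linarith
  have hP : ∀ᶠ X : ℝ in atTop, δ₀ * (X / Real.log X ^ (B + 1)) ≤ ∑ p ∈ Nat.primesLE ⌊X⌋₊, A.a p := by
    filter_upwards [hfloor, hdense, eventually_gt_atTop (1 : ℝ)] with X hXf hXd hX1
    have hL : 0 < Real.log X := Real.log_pos hX1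
    have e : X / Real.log X ^ (B + 1) = (X / Real.log X ^ B) / Real.log X := by
      rw [Real.rpow_add_one hL.ne', div_div]
    rw [e]
    calc δ₀ * (X / Real.log X ^ B / Real.log X) ≤ δ₀ * (A.size X / Real.log X) :=
          mul_le_mul_of_nonneg_left (div_le_div_of_nonneg_right hXd hL.le) hδ₀.le
      _ ≤ _ := hXf
  -- pull back along `X_x = f_m(x) = a x + b`
  have hXeq : ∀ᶠ x : ℕ in atTop, ((((a * x + b).toNat : ℕ) : ℝ)) = (a : ℝ) * x + b := by
    filter_upwards [(PrimeBackground.tendsto_linear_atTop ha0 (b : ℝ)).eventually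
      (eventually_ge_atTop (0 : ℝ))] with x hx
    have h0 : 0 ≤ a * (x : ℤ) + b := by exact_mod_cast hx
    have : (((a * x + b).toNat : ℕ) : ℤ) = a * x + b := Int.toNat_of_nonneg h0
    exact_mod_cast this
  have htX : Tendsto (fun x : ℕ => ((((a * x + b).toNat : ℕ) : ℝ))) atTop atTop :=
    (PrimeBackground.tendsto_linear_atTop ha0 (b : ℝ)).congr' (hXeq.mono fun x hx => hx.symm)
  have hshare' := htX.eventually hshare
  have hO' := htX.eventually hO
  have hP' := htX.eventually hP
  -- the error budget and the absence of large `Ω`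
  set B₀ : ℝ := ∑ i : Fin k, (((f i).coeff 0).natAbs : ℝ) with hB₀
  have hB₀0 : 0 ≤ B₀ := Finset.sum_nonneg fun i _ => Nat.cast_nonneg _
  have hbudget := PrimeBackground.eventually_errors_le ha1 hU1 (B + 1) (C₁ := (T + 1) * k)
    (C₂ := (T + 1) * B₀) (by positivity) (by positivity) (show 0 < ε * (T / 2) * δ₀ by positivity) (b := (b : ℝ))
  have hbig := PrimeBackground.eventually_pow_threshold_gt (a : ℝ) (b : ℝ) hU1.le
  filter_upwards [hshare', hO', hP', hbudget, hbig, hXeq, eventually_ge_atTop 1] with x hxs hxO hxP hxb hxbig hxX hx1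
  -- notation at `x`
  set z : ℕ := ⌈(x : ℝ) ^ (1 / U)⌉₊ with hz
  obtain ⟨hz1, hz2, hz3⟩ := PrimeBackground.threshold_bounds hx1 hU0
  set M : ℕ := (a * x + b).toNat with hM
  have hMfloor : ⌊((M : ℕ) : ℝ)⌋₊ = M := Nat.floor_natCast M
  have hyz : y (M : ℝ) = (z : ℝ) := by
    rw [hy, hz]
    simp only
    rw [hxX, add_sub_cancel_right, mul_comm, mul_div_assoc, div_self ha0.ne', mul_one]
  rw [hyz] at hxs hxO
  rw [hMfloor] at hxO hxP
  -- identifications of the sequence's cells with counts on the background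
  have hC1 := PrimeBackground.primeCellAt_eq_card ha bg hw1' hw0' x (z : ℝ)
  have hOdd := PrimeBackground.oddCells_eq_card ha bg (A := A) hw1' hw0' x R (z : ℝ)
  -- rewrite the depth exponents `deg fᵢ/U = 1/U`, and name the threshold
  simp only [hdeg1, Nat.cast_one]
  simp only [← hz]
  -- the two crux cells and the auxiliary sets
  set Rz := (Finset.Icc 1 x).filter (fun n : ℕ => ∀ i, 0 < (f i).eval (n : ℤ) ∧
      ∀ p ∈ Finset.range z, p.Prime → ¬ ((p : ℤ) ∣ (f i).eval (n : ℤ))) with hRz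
  set Cp := Rz.filter (fun n : ℕ => ∀ i : Fin k, ((i : ℕ) < (m : ℕ) + 1 →
      Ω (((f i).eval (n : ℤ)).toNat) = 1) ∧ ((m : ℕ) + 1 ≤ (i : ℕ) → Odd (Ω (((f i).eval (n : ℤ)).toNat))))
    with hCp
  set Cm := Rz.filter (fun n : ℕ => ∀ i : Fin k, ((i : ℕ) < (m : ℕ) →
      Ω (((f i).eval (n : ℤ)).toNat) = 1) ∧ ((m : ℕ) ≤ (i : ℕ) → Odd (Ω (((f i).eval (n : ℤ)).toNat))))
    with hCm
  set N := (Finset.Icc 1 x).filter (fun n : ℕ => bg n) with hN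
  set C1set := N.filter (fun n : ℕ => ((a * n + b).toNat).Prime ∧ (z : ℝ) ≤ (((a * n + b).toNat : ℕ) : ℝ))
    with hC1set
  set Oddset := N.filter (fun n : ℕ => Squarefree ((a * n + b).toNat) ∧ Odd (ω ((a * n + b).toNat)) ∧
      ω ((a * n + b).toNat) ≤ R ∧ (z : ℝ) ≤ ((Nat.minFac ((a * n + b).toNat) : ℕ) : ℝ)) with hOddset
  set Esm := (Finset.Icc 1 x).filter (fun n : ℕ => ∃ i : Fin k, (i : ℕ) < (m : ℕ) ∧ (f i).eval (n : ℤ) < z)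
    with hEsm
  set E2set := (Finset.Icc 1 x).filter (fun n : ℕ => 0 < a * n + b ∧ (∀ p ∈ Finset.range z, p.Prime →
      ¬ ((p : ℤ) ∣ a * n + b)) ∧ ¬ Squarefree (a * n + b).toNat) with hE2set
  -- the Literature quantities are `#C1set` and `#Oddset`
  have hC1val : BombieriRoughCells.roughCellAt A 1 (z : ℝ) (M : ℝ) = (C1set.card : ℝ) := by
    rw [hC1set, hN, ← PrimeBackground.primeCellAt_eq_card ha bg hw1' hw0' x (z : ℝ)]
    unfold BombieriRoughCells.roughCellAt
    rw [BombieriRoughCells.filter_one_eq_primesLE, hMfloor]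
    refine Finset.sum_congr ?_ fun _ _ => rfl
    refine Finset.filter_congr fun q hq => ?_
    rw [(Nat.mem_primesLE.mp hq).2.minFac_eq]
  have hOval : BombieriRoughCells.oddCells A R (z : ℝ) (M : ℝ) = (Oddset.card : ℝ) := by
    rw [hOddset, hN]
    exact PrimeBackground.oddCells_eq_card ha bg hw1' hw0' x R (z : ℝ)
  rw [hC1val, hOval] at hxs
  rw [hOval] at hxO
  rw [hxX] at hxP
  -- facts about the other members at `n ∉ Esm`
  have hge_of_notMem : ∀ n : ℕ, n ∈ Finset.Icc 1 x → n ∉ Esm →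
      ∀ i : Fin k, (i : ℕ) < (m : ℕ) → (z : ℤ) ≤ (f i).eval (n : ℤ) := by
    intro n hnx hE i hi
    by_contra hlt
    exact hE (by rw [hEsm, Finset.mem_filter]; exact ⟨hnx, i, hi, not_le.mp hlt⟩)
  have toNat_ge : ∀ {v : ℤ}, (z : ℤ) ≤ v → z ≤ v.toNat := fun {v} h => by
    have : (z : ℤ) ≤ (v.toNat : ℤ) := h.trans (Int.self_le_toNat v)
    exact_mod_cast this
  -- (i1) `Cp ⊆ C1set`
  have i1 : Cp ⊆ C1set := by
    intro n hn
    rw [hCp, Finset.mem_filter, hRz, Finset.mem_filter] at hn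
    obtain ⟨⟨hnx, hRn⟩, hΩ⟩ := hn
    have hprime : ∀ i, (((f i).eval (n : ℤ)).toNat).Prime := fun i =>
      PrimeBackground.cardFactors_toNat_eq_one_iff.mp ((hΩ i).1 (by have := i.is_lt; omega))
    rw [hC1set, Finset.mem_filter, hN, Finset.mem_filter]
    refine ⟨⟨hnx, fun i _ => hprime i⟩, ?_, ?_⟩
    · rw [← hev]; exact hprime m
    · have := PrimeBackground.le_of_prime_of_rough (hprime m) (hRn m).2
      rw [hev] at this; exact_mod_cast this
  -- (i2) `C1set ⊆ Cp ∪ Esm`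
  have i2 : C1set ⊆ Cp ∪ Esm := by
    intro n hn
    rw [Finset.mem_union]
    by_cases hE : n ∈ Esm
    · exact Or.inr hE
    left
    rw [hC1set, Finset.mem_filter, hN, Finset.mem_filter] at hn
    obtain ⟨⟨hnx, hbgn⟩, hpm, hzm⟩ := hn
    have hzm' : z ≤ (a * n + b).toNat := by exact_mod_cast hzm
    have hge := hge_of_notMem n hnx hE
    have hall : ∀ i : Fin k, (((f i).eval (n : ℤ)).toNat).Prime ∧ z ≤ ((f i).eval (n : ℤ)).toNat := by
      intro i
      by_cases hi : (i : ℕ) < (m : ℕ)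
      · exact ⟨hbgn i hi, toNat_ge (hge i hi)⟩
      · have him : i = m := Fin.ext (by have := i.is_lt; omega)
        rw [him, hev]; exact ⟨hpm, hzm'⟩
    rw [hCp, Finset.mem_filter, hRz, Finset.mem_filter]
    refine ⟨⟨hnx, fun i => ⟨PrimeBackground.pos_of_toNat_prime (hall i).1,
      PrimeBackground.rough_of_prime_of_le (hall i).1 (hall i).2⟩⟩, fun i => ⟨fun _ =>
      PrimeBackground.cardFactors_toNat_eq_one_iff.mpr (hall i).1, fun hi => absurd i.is_lt (by omega)⟩⟩
  -- (i3) `Oddset ⊆ Cm ∪ Esm`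
  have i3 : Oddset ⊆ Cm ∪ Esm := by
    intro n hn
    rw [Finset.mem_union]
    by_cases hE : n ∈ Esm
    · exact Or.inr hE
    left
    rw [hOddset, Finset.mem_filter, hN, Finset.mem_filter] at hn
    obtain ⟨⟨hnx, hbgn⟩, hsq, hodd, -, hzmin⟩ := hn
    have hge := hge_of_notMem n hnx hE
    have hv0' : (a * n + b).toNat ≠ 0 := fun h => by rw [h] at hsq; exact not_squarefree_zero hsq
    have hvpos : 0 < a * n + b := by
      by_contra h; exact hv0' (Int.toNat_of_nonpos (not_lt.mp h))
    have hΩodd : Odd (Ω (a * n + b).toNat) := by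
      rwa [← (ArithmeticFunction.cardDistinctFactors_eq_cardFactors_iff_squarefree hv0').mpr hsq]
    have hzmin' : z ≤ (a * n + b).toNat.minFac := by exact_mod_cast hzmin
    have hvrough := PrimeBackground.rough_of_le_minFac hvpos hzmin'
    have hoth : ∀ i : Fin k, (i : ℕ) < (m : ℕ) →
        (((f i).eval (n : ℤ)).toNat).Prime ∧ z ≤ ((f i).eval (n : ℤ)).toNat :=
      fun i hi => ⟨hbgn i hi, toNat_ge (hge i hi)⟩
    rw [hCm, Finset.mem_filter, hRz, Finset.mem_filter]
    refine ⟨⟨hnx, fun i => ?_⟩, fun i => ⟨fun hi =>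
      PrimeBackground.cardFactors_toNat_eq_one_iff.mpr (hoth i hi).1, fun hi => ?_⟩⟩
    · by_cases hi : (i : ℕ) < (m : ℕ)
      · exact ⟨PrimeBackground.pos_of_toNat_prime (hoth i hi).1,
          PrimeBackground.rough_of_prime_of_le (hoth i hi).1 (hoth i hi).2⟩
      · have him : i = m := Fin.ext (by have := i.is_lt; omega)
        rw [him, hev]; exact ⟨hvpos, hvrough⟩
    · have him : i = m := Fin.ext (by have := i.is_lt; omega)
      rw [him, hev]; exact hΩodd
  -- (i4) `Cm ⊆ Oddset ∪ E2set` (no large `Ω` at this `x`)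
  have i4 : Cm ⊆ Oddset ∪ E2set := by
    intro n hn
    rw [Finset.mem_union]
    rw [hCm, Finset.mem_filter, hRz, Finset.mem_filter] at hn
    obtain ⟨⟨hnx, hRn⟩, hcell⟩ := hn
    have hvpos : 0 < a * n + b := by rw [← hev]; exact (hRn m).1
    have hvrough : ∀ p ∈ Finset.range z, p.Prime → ¬ ((p : ℤ) ∣ a * n + b) := by
      rw [← hev]; exact (hRn m).2
    have hΩodd : Odd (Ω (a * n + b).toNat) := by rw [← hev]; exact (hcell m).2 le_rfl
    by_cases hsq : Squarefree (a * n + b).toNat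
    · left
      have hbgn : bg n := fun i hi => PrimeBackground.cardFactors_toNat_eq_one_iff.mp ((hcell i).1 hi)
      have hv1 : 1 < (a * n + b).toNat := PrimeBackground.one_lt_toNat_of_odd hΩodd
      have hv0 : (a * n + b).toNat ≠ 0 := by omega
      have hωΩ : ω (a * n + b).toNat = Ω (a * n + b).toNat :=
        (ArithmeticFunction.cardDistinctFactors_eq_cardFactors_iff_squarefree hv0).mpr hsq
      have hΩle : Ω (a * n + b).toNat ≤ R := by
        refine PrimeBackground.cardFactors_le_of_rough hv0 hz3 (fun p hp hpv => ?_) ?_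
        · by_contra hlt
          refine hvrough p (Finset.mem_range.mpr (not_le.mp hlt)) hp ?_
          rwa [PrimeBackground.natCast_dvd_iff_dvd_toNat hvpos]
        · -- `(a n + b).toNat ≤ a x + b < z^{R+1}`
          have h1 : (((a * n + b).toNat : ℕ) : ℝ) ≤ (a : ℝ) * x + b := by
            have e : (((a * n + b).toNat : ℕ) : ℤ) = a * n + b := Int.toNat_of_nonneg hvpos.le
            have hnx' : (n : ℤ) ≤ x := by exact_mod_cast (Finset.mem_Icc.mp hnx).2
            have : (((a * n + b).toNat : ℕ) : ℤ) ≤ a * x + b := by rw [e]; nlinarith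
            exact_mod_cast this
          have h2 : (((a * n + b).toNat : ℕ) : ℝ) < ((z ^ (R + 1) : ℕ) : ℝ) := by
            push_cast; exact lt_of_le_of_lt h1 hxbig
          exact_mod_cast h2
      rw [hOddset, Finset.mem_filter, hN, Finset.mem_filter]
      refine ⟨⟨hnx, hbgn⟩, hsq, by rwa [hωΩ], by rwa [hωΩ], ?_⟩
      exact_mod_cast PrimeBackground.le_minFac_of_rough hv1 hvrough
    · right
      rw [hE2set, Finset.mem_filter]
      exact ⟨hnx, hvpos, hvrough, hsq⟩
  -- cardinalities of the error sets
  have cEsm : (Esm.card : ℝ) ≤ (k : ℝ) * z + B₀ := by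
    have hsub : Esm ⊆ (Finset.univ : Finset (Fin k)).biUnion
        (fun i => (Finset.Icc 1 x).filter (fun n : ℕ => (f i).coeff 1 * n + (f i).coeff 0 < z)) := by
      intro n hn
      rw [hEsm, Finset.mem_filter] at hn
      obtain ⟨hnx, i, -, hlt⟩ := hn
      rw [Finset.mem_biUnion]
      refine ⟨i, Finset.mem_univ i, Finset.mem_filter.mpr ⟨hnx, ?_⟩⟩
      rw [← (PrimeBackground.linear_member hf hdeg i).2.1 n]; exact hlt
    have h1 : Esm.card ≤ ∑ i : Fin k, (z + ((f i).coeff 0).natAbs) :=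
      (Finset.card_le_card hsub).trans ((Finset.card_biUnion_le).trans (Finset.sum_le_sum fun i _ =>
        PrimeBackground.card_filter_eval_lt_le (PrimeBackground.linear_member hf hdeg i).1 x z))
    have h2 : (Esm.card : ℝ) ≤ ((∑ i : Fin k, (z + ((f i).coeff 0).natAbs) : ℕ) : ℝ) := by
      exact_mod_cast h1
    refine h2.trans (le_of_eq ?_)
    push_cast
    rw [Finset.sum_add_distrib, Finset.sum_const, Finset.card_univ, Fintype.card_fin, nsmul_eq_mul, hB₀]
  have cE2 : (E2set.card : ℝ) ≤ 2 * (x : ℝ) / z + Real.sqrt ((a : ℝ) * x + b) + 1 := by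
    have h := PrimeBackground.card_nonSquarefree_rough_le ha hcop x hz3 (M := M) (Int.self_le_toNat _)
    have hsq : ((Nat.sqrt M : ℕ) : ℝ) ≤ Real.sqrt ((a : ℝ) * x + b) := by
      rw [← hxX]; exact Real.nat_sqrt_le_real_sqrt
    rw [hE2set]
    linarith
  -- the budget `(T+1)·#Esm + #E2set ≤ ε·#Oddset`
  have hTpos : 0 < T := by linarith
  have hbud : (T + 1) * (Esm.card : ℝ) + (E2set.card : ℝ) ≤ ε * (Oddset.card : ℝ) := by
    have h1 : (T + 1) * (Esm.card : ℝ) ≤ (T + 1) * k * z + (T + 1) * B₀ := by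
      calc (T + 1) * (Esm.card : ℝ) ≤ (T + 1) * ((k : ℝ) * z + B₀) :=
            mul_le_mul_of_nonneg_left cEsm (by linarith)
        _ = (T + 1) * k * z + (T + 1) * B₀ := by ring
    have h3 : ε * (T / 2) * δ₀ * (((a : ℝ) * x + b) / Real.log ((a : ℝ) * x + b) ^ (B + 1)) ≤
        ε * (Oddset.card : ℝ) := by
      calc ε * (T / 2) * δ₀ * (((a : ℝ) * x + b) / Real.log ((a : ℝ) * x + b) ^ (B + 1))
          = ε * ((T / 2) * (δ₀ * (((a : ℝ) * x + b) / Real.log ((a : ℝ) * x + b) ^ (B + 1)))) := by ring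
        _ ≤ ε * ((T / 2) * ∑ p ∈ Nat.primesLE M, A.a p) :=
            mul_le_mul_of_nonneg_left (mul_le_mul_of_nonneg_left hxP (by positivity)) hε0.le
        _ ≤ ε * (Oddset.card : ℝ) := mul_le_mul_of_nonneg_left hxO hε0.le
    linarith
  -- assemble
  have key := PrimeBackground.anatomy_of_share (T := T) (cp := (Cp.card : ℝ)) (cm := (Cm.card : ℝ))
    hT1 hε0.le hε1 (Nat.cast_nonneg _) (Nat.cast_nonneg _) (Nat.cast_nonneg _) (Nat.cast_nonneg _)
    hxs (by exact_mod_cast Finset.card_le_card i1)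
    (by have := (Finset.card_le_card i2).trans (Finset.card_union_le _ _); exact_mod_cast this)
    (by have := (Finset.card_le_card i3).trans (Finset.card_union_le _ _); exact_mod_cast this)
    (by have := (Finset.card_le_card i4).trans (Finset.card_union_le _ _); exact_mod_cast this)
    hbud
  have hcm0 : (0 : ℝ) ≤ (Cm.card : ℝ) := Nat.cast_nonneg _
  calc |(Cp.card : ℝ) * T - (Cm.card : ℝ)| ≤ 3 * ε * (Cm.card : ℝ) := key
    _ ≤ η * (Cm.card : ℝ) := mul_le_mul_of_nonneg_right hε3 hcm0

/-- **Sub-goal (the prime-background step)**, registered on crux stmt-Parity-15629 as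
`stub_primeBackgroundAnatomy`, verbatim (`mixedShareAnatomy_of_primeBackgroundBombieri`). [folklore] -/
theorem stub_primeBackgroundAnatomy :
    Literature.NumberTheory.Sieve.Bombieri1976_PrDistributionMin → ∀ (k : ℕ) (f : Fin k →
    Polynomial ℤ), Literature.NumberTheory.Sieve.IsBatemanHornSystem f → (∀ i, (f i).natDegree ≤ 1)
    → ∀ m : Fin k, (m : ℕ) + 1 = k → (∃ (A : Literature.NumberTheory.Sieve.SieveSequence) (H δ₀ B :
    ℝ), (∀ (v n : ℕ), 1 ≤ n → (f m).eval (n : ℤ) = v → (∀ i : Fin k, (i : ℕ) < (m : ℕ) → (((f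
    i).eval (n : ℤ)).toNat).Prime) → A.a v = 1) ∧ (∀ v : ℕ, (∀ n : ℕ, 1 ≤ n → (f m).eval (n : ℤ) =
    v → ¬ (∀ i : Fin k, (i : ℕ) < (m : ℕ) → (((f i).eval (n : ℤ)).toNat).Prime)) → A.a v = 0) ∧
    A.IsBombieriSequence ∧ A.HasDensityConstant H ∧ 0 < δ₀ ∧ (∀ᶠ X : ℝ in Filter.atTop, δ₀ *
    (A.size X / Real.log X) ≤ ∑ p ∈ Nat.primesLE ⌊X⌋₊, A.a p) ∧ (∀ᶠ X : ℝ in Filter.atTop, X /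
    Real.log X ^ B ≤ A.size X)) → ∀ η : ℝ, 0 < η → ∃ U₀ : ℝ, ∀ U : ℝ, U₀ ≤ U → ∀ᶠ x : ℕ in
    Filter.atTop, |(((((Finset.Icc 1 x).filter (fun n : ℕ => ∀ i, 0 < (f i).eval (n : ℤ) ∧ ∀ p ∈
    Finset.range ⌈(x : ℝ) ^ (((f i).natDegree : ℝ) / U)⌉₊, p.Prime → ¬ ((p : ℤ) ∣ (f i).eval (n :
    ℤ)))).filter (fun n : ℕ => ∀ i : Fin k, ((i : ℕ) < (m : ℕ) + 1 → ArithmeticFunction.cardFactors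
    (((f i).eval (n : ℤ)).toNat) = 1) ∧ ((m : ℕ) + 1 ≤ (i : ℕ) → Odd
    (ArithmeticFunction.cardFactors (((f i).eval (n : ℤ)).toNat))))).card : ℕ) : ℝ) * (∑ j ∈
    (Finset.range (⌊U⌋₊ + 1)).filter Odd, Literature.NumberTheory.Sieve.roughCellDensity j U) -
    (((((Finset.Icc 1 x).filter (fun n : ℕ => ∀ i, 0 < (f i).eval (n : ℤ) ∧ ∀ p ∈ Finset.range ⌈(x
    : ℝ) ^ (((f i).natDegree : ℝ) / U)⌉₊, p.Prime → ¬ ((p : ℤ) ∣ (f i).eval (n : ℤ)))).filter (fun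
    n : ℕ => ∀ i : Fin k, ((i : ℕ) < (m : ℕ) → ArithmeticFunction.cardFactors (((f i).eval (n :
    ℤ)).toNat) = 1) ∧ ((m : ℕ) ≤ (i : ℕ) → Odd (ArithmeticFunction.cardFactors (((f i).eval (n :
    ℤ)).toNat))))).card : ℕ) : ℝ)| ≤ η * (((((Finset.Icc 1 x).filter (fun n : ℕ => ∀ i, 0 < (f
    i).eval (n : ℤ) ∧ ∀ p ∈ Finset.range ⌈(x : ℝ) ^ (((f i).natDegree : ℝ) / U)⌉₊, p.Prime → ¬ ((p
    : ℤ) ∣ (f i).eval (n : ℤ)))).filter (fun n : ℕ => ∀ i : Fin k, ((i : ℕ) < (m : ℕ) →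
    ArithmeticFunction.cardFactors (((f i).eval (n : ℤ)).toNat) = 1) ∧ ((m : ℕ) ≤ (i : ℕ) → Odd
    (ArithmeticFunction.cardFactors (((f i).eval (n : ℤ)).toNat))))).card : ℕ) : ℝ) :=
  mixedShareAnatomy_of_primeBackgroundBombieri

end Summit.Parity.BatemanHorn.Cruxes.OddSectorShareLinear.Birth

end
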